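import Summits.NavierStokesRegularity.NavierStokesRegularity.Theorems.ScalingDefectPeepholeDoorSerrinSpinL2
import Literature.Analysis.FluidPDE.NSBootstrapBase
import HarnessLib

/-!
# ScalingDefectPeepholeDoorSerrinGradientL2 — door S30 «ScalingDefectPeepholeDoor», effective plate E0 (step E2):
# the PRESSURE-FREE energy-class bound `∇u ∈ L²` for bounded distributional Navier–Stokes solutions

Fifth file of the pressure-free Serrin chain (`…SerrinPointwise`, `…SerrinSlab`, `…SerrinSpinDuality`,
`…SerrinSpinL2`).  The tree's quantitative Serrin bootstrap (`NSBootstrap.spin_bound_backward_quant`,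
`NSBootstrap.level_step`) is pressure-free except for its START `NSEnergyQuant.exists_weakGradient_energy_bound`,
which bounds `∬ |∇u|²` by `(1 + |M|)³ (1 + ‖p‖_{3/2})`.  This file replaces that start: **on
`Q = Q*_R(-R², 0) = ]-2R², 0[ × B(0, R)`, a distributional Navier–Stokes solution (`ν = 1`, `f = 0`) with
`|u| ≤ M` a.e. and a weak spatial gradient `G` (no integrability assumed, nothing on `p`) has
`∬_{]-R₁²,0[×B(0,R₁)} |G|² ≤ C (|M| + M²)²`, `C = C(R, R₁)`, for every `0 < R₁ < R`.**  Proof: the spin entries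
are in `L²` by `Serrin.spinEntry_memLp_two` (step E1); each velocity component solves the very weak
Poisson equation `Δu_b = Σ_c ∂_c A_{bc}` (`NSBootstrap.basePoisson_of_weakGradient`, incompressibility),
so the sliced elliptic estimate `RepDeriv.exists_L2_partial_of_poisson` produces `L²` representatives of
`∂ᵢu_b` with the bound, and these agree a.e. with the entries of `G` (uniqueness of representatives of a
distributional derivative, `RepDeriv.IsRepDeriv.ae_eq`) (Serrin 1962; Chen–Strain–Tsai–Yau 2009,
Lemma A.2).

Door S30 is a regularity CRITERION inside a HYPOTHETICAL local Type-I blow-up; item 0056 `NoTypeII`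
stays OPEN; nothing here bears on NS regularity itself.
-/

noncomputable section

set_option linter.dupNamespace false

namespace Summit.NavierStokesRegularity.NavierStokesRegularity.Theorems.ScalingDefectPeepholeDoor

namespace Serrin

open MeasureTheory Set Function Filter Topology TopologicalSpace Metric InnerProductSpace
open scoped NNReal ENNReal RealInnerProductSpace Laplacian ContDiff
open Literature.Analysis Literature.Analysis.FluidPDE

/-! ### Entries of the weak gradient represent the first derivatives -/

/-- The entry `G_{bi} = (G eᵢ)_b` of a weak spatial gradient on the centred cylinder represents the
distributional derivative `∂ᵢ u_b` on every smaller open set. [folklore] -/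
theorem isRepDeriv_gradE {R : ℝ} {z : ℝ × EuclideanSpace ℝ (Fin 3)}
    {u : ℝ → EuclideanSpace ℝ (Fin 3) → EuclideanSpace ℝ (Fin 3)}
    {G : ℝ → EuclideanSpace ℝ (Fin 3) → EuclideanSpace ℝ (Fin 3) →L[ℝ] EuclideanSpace ℝ (Fin 3)}
    (hG : HasWeakSpatialGradientOn (parabolicCylinderCenteredOpens R z) u G)
    {Q' : Opens (ℝ × EuclideanSpace ℝ (Fin 3))} (hQ' : Q' ≤ parabolicCylinderCenteredOpens R z)
    (b i : Fin 3) :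
    RepDeriv.IsRepDeriv Q' (fun q => u q.1 q.2 b) [EuclideanSpace.basisFun (Fin 3) ℝ i]
      (NSSpinHeat.gradE G b i) := by
  have hGl := hG.locallyIntegrableOn_grad
  have hu := hG.locallyIntegrableOn
  refine ⟨?_, ?_, fun ψ hψ => ?_⟩
  · exact ((NSSpinHeat.locallyIntegrableOn_velC hu b).mono_set hQ')
  · exact ((NSSpinHeat.locallyIntegrableOn_gradE hGl b i).mono_set hQ')
  · have h := NSSpinHeat.integral_test_mul_gradE hG (hψ.mono hQ') b i
    rw [RepDeriv.derivs_singleton]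
    simp only [List.length_singleton, pow_one, neg_mul, one_mul]
    have e1 : (EuclideanSpace.basisFun (Fin 3) ℝ i : EuclideanSpace ℝ (Fin 3)) =
        EuclideanSpace.single i (1 : ℝ) := by simp
    rw [e1]
    calc ∫ q : ℝ × EuclideanSpace ℝ (Fin 3), u q.1 q.2 b * fderiv ℝ (ψ q.1) q.2 (EuclideanSpace.single i (1 : ℝ))
        = ∫ q : ℝ × EuclideanSpace ℝ (Fin 3),
            fderiv ℝ (ψ q.1) q.2 (EuclideanSpace.single i (1 : ℝ)) * NSSpinHeat.velC u b q :=
          integral_congr_ae (Eventually.of_forall fun q => by simp only [NSSpinHeat.velC_apply, mul_comm])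
      _ = -∫ q : ℝ × EuclideanSpace ℝ (Fin 3), ψ q.1 q.2 * NSSpinHeat.gradE G b i q := by
          rw [h, neg_neg]
      _ = -∫ q : ℝ × EuclideanSpace ℝ (Fin 3), NSSpinHeat.gradE G b i q * ψ q.1 q.2 := by
          congr 1
          exact integral_congr_ae (Eventually.of_forall fun q => mul_comm _ _)

/-! ### The pressure-free energy-class bound -/

set_option maxHeartbeats 1600000 in
/-- **Pressure-free `L²` bound for the weak gradient** (Serrin 1962; Chen–Strain–Tsai–Yau 2009, Lemma
A.2: interior estimates for bounded Navier–Stokes solutions without the pressure).  On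
`Q = Q*_R(-R², 0) = ]-2R², 0[ × B(0, R)`: for `0 < R₁ < R` there is `C = C(R, R₁)` such that every
distributional Navier–Stokes solution `(u, p)` (`ν = 1`, `f = 0`) with `|u| ≤ M` a.e. on `Q` and a weak
spatial gradient `G` on `Q` has `∬_{]-R₁²,0[×B(0,R₁)} |G|²_{Frob} ≤ C (|M| + M²)²`. [folklore] -/
theorem lintegral_frobeniusNormSq_le {R R₁ : ℝ} (hR₁ : 0 < R₁) (hR₁R : R₁ < R) :
    ∃ C : ℝ, 0 ≤ C ∧ ∀ (M : ℝ) (u : ℝ → EuclideanSpace ℝ (Fin 3) → EuclideanSpace ℝ (Fin 3))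
      (p : ℝ → EuclideanSpace ℝ (Fin 3) → ℝ)
      (G : ℝ → EuclideanSpace ℝ (Fin 3) → EuclideanSpace ℝ (Fin 3) →L[ℝ] EuclideanSpace ℝ (Fin 3)),
      IsDistributionalNSSolutionOn
        (parabolicCylinderCenteredOpens R ((-R ^ 2 : ℝ), (0 : EuclideanSpace ℝ (Fin 3)))) 1 0 u p →
      (∀ᵐ q ∂(volume.restrict
        (parabolicCylinderCentered R ((-R ^ 2 : ℝ), (0 : EuclideanSpace ℝ (Fin 3))))), ‖u q.1 q.2‖ ≤ M) →
      HasWeakSpatialGradientOn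
        (parabolicCylinderCenteredOpens R ((-R ^ 2 : ℝ), (0 : EuclideanSpace ℝ (Fin 3)))) u G →
      ∫⁻ q in Ioo (-R₁ ^ 2) 0 ×ˢ ball (0 : EuclideanSpace ℝ (Fin 3)) R₁,
          ENNReal.ofReal (frobeniusNormSq (G q.1 q.2)) ≤ ENNReal.ofReal (C * (|M| + M ^ 2) ^ 2) := by
  have hR : 0 < R := hR₁.trans hR₁R
  set ρm : ℝ := (R₁ + R) / 2 with hρm
  have hρm0 : 0 < ρm := by rw [hρm]; linarith
  have hR₁ρm : R₁ < ρm := by rw [hρm]; linarith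
  have hρmR : ρm < R := by rw [hρm]; linarith
  have hL'0 : 0 < R₁ ^ 2 := by positivity
  have hL' : R₁ ^ 2 < 2 * R ^ 2 := by nlinarith
  obtain ⟨C₁, hC₁0, hC₁⟩ := spinEntry_memLp_two hR hL'0 hL' hρm0 hρmR
  obtain ⟨C₂, hC₂⟩ := RepDeriv.exists_L2_partial_of_poisson (L := R₁ ^ 2) hR₁ hR₁ρm
  -- the cylinders
  set z₀ : ℝ × EuclideanSpace ℝ (Fin 3) := ((-R ^ 2 : ℝ), (0 : EuclideanSpace ℝ (Fin 3))) with hz₀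
  set Qs : Set (ℝ × EuclideanSpace ℝ (Fin 3)) := parabolicCylinderCentered R z₀ with hQs
  set Qo : Opens (ℝ × EuclideanSpace ℝ (Fin 3)) := parabolicCylinderCenteredOpens R z₀ with hQo
  set Q' : Set (ℝ × EuclideanSpace ℝ (Fin 3)) := Ioo (-R₁ ^ 2) 0 ×ˢ ball (0 : EuclideanSpace ℝ (Fin 3)) ρm
    with hQ'
  set Qo' : Opens (ℝ × EuclideanSpace ℝ (Fin 3)) := ⟨Q', isOpen_Ioo.prod isOpen_ball⟩ with hQo'
  set Q'' : Set (ℝ × EuclideanSpace ℝ (Fin 3)) := Ioo (-R₁ ^ 2) 0 ×ˢ ball (0 : EuclideanSpace ℝ (Fin 3)) R₁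
    with hQ''
  set Qo'' : Opens (ℝ × EuclideanSpace ℝ (Fin 3)) := ⟨Q'', isOpen_Ioo.prod isOpen_ball⟩ with hQo''
  have hQ'Q : Q' ⊆ Qs := by
    intro q hq
    show q ∈ parabolicCylinderCentered R z₀
    simp only [parabolicCylinderCentered, hz₀, mem_prod, mem_Ioo, mem_ball]
    have h3 : dist q.2 0 < ρm := hq.2
    exact ⟨⟨by nlinarith [hq.1.1], by nlinarith [hq.1.2]⟩, by linarith⟩
  have hQoQ : Qo' ≤ Qo := hQ'Q
  have hQ''Q' : Q'' ⊆ Q' := prod_mono le_rfl (ball_subset_ball hR₁ρm.le)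
  have hQo''Q : Qo'' ≤ Qo := fun q hq => hQ'Q (hQ''Q' hq)
  have hQ'meas : MeasurableSet Q' := (isOpen_Ioo.prod isOpen_ball).measurableSet
  have hQ''meas : MeasurableSet Q'' := (isOpen_Ioo.prod isOpen_ball).measurableSet
  have hQ'fin : volume Q' < ⊤ := by
    rw [hQ', Measure.volume_eq_prod, Measure.prod_prod]
    exact ENNReal.mul_lt_top (by simp [Real.volume_Ioo]) measure_ball_lt_top
  set V : ℝ := ((volume Q') ^ (1 / 2 : ℝ)).toReal with hV
  have hV0 : 0 ≤ V := ENNReal.toReal_nonneg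
  -- the constant
  set K₀ : ℝ := (C₂ : ℝ) * (V + 3 * C₁) with hK₀
  have hK₀0 : 0 ≤ K₀ := by positivity
  refine ⟨9 * K₀ ^ 2, by positivity, fun M u p G hsol hbd hG => ?_⟩
  have hM0 : 0 ≤ |M| := abs_nonneg M
  set N : ℝ := |M| + M ^ 2 with hN
  have hN0 : 0 ≤ N := by positivity
  have hMN : |M| ≤ N := by rw [hN]; linarith [sq_nonneg M]
  -- Step 1: the spin entries in `L²(Q')`
  have hA : ∀ b c : Fin 3, MemLp (spinEntry G b c) 2 (volume.restrict Q') ∧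
      eLpNorm (spinEntry G b c) 2 (volume.restrict Q') ≤ ENNReal.ofReal (C₁ * N) :=
    fun b c => hC₁ M u p G hsol hbd hG b c
  -- Step 2: the velocity components in `L²(Q')`
  have hu : LocallyIntegrableOn (uncurry u) Qs volume := hsol.1
  have hbd' : ∀ᵐ q ∂(volume.restrict Q'), ‖u q.1 q.2‖ ≤ |M| :=
    (ae_restrict_of_ae_restrict_of_subset hQ'Q hbd).mono fun q hq => hq.trans (le_abs_self M)
  have hU : ∀ b : Fin 3, MemLp (fun q : ℝ × EuclideanSpace ℝ (Fin 3) => u q.1 q.2 b) 2 (volume.restrict Q') ∧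
      eLpNorm (fun q : ℝ × EuclideanSpace ℝ (Fin 3) => u q.1 q.2 b) 2 (volume.restrict Q') ≤
        ENNReal.ofReal (V * |M|) := by
    intro b
    have hm : AEStronglyMeasurable (fun q : ℝ × EuclideanSpace ℝ (Fin 3) => u q.1 q.2 b) (volume.restrict Q') :=
      ((NSSpinHeat.locallyIntegrableOn_velC hu b).mono_set hQ'Q).aestronglyMeasurable
    have hbdb : ∀ᵐ q ∂(volume.restrict Q'), ‖u q.1 q.2 b‖ ≤ |M| :=
      hbd'.mono fun q hq => (PiLp.norm_apply_le (u q.1 q.2) b).trans hq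
    obtain ⟨h1, h2⟩ := memLp_indicator_of_ae_bound hQ'meas hQ'fin hm hbdb
    rw [memLp_indicator_iff_restrict hQ'meas] at h1
    rw [eLpNorm_indicator_eq_eLpNorm_restrict hQ'meas] at h2
    refine ⟨h1, h2.trans (le_of_eq ?_)⟩
    have hVfin : (volume Q') ^ (1 / 2 : ℝ) ≠ ⊤ := ENNReal.rpow_ne_top_of_nonneg (by norm_num) hQ'fin.ne
    rw [ENNReal.ofReal_mul hV0, hV, ENNReal.ofReal_toReal hVfin]
  -- Step 3: the very weak Poisson equations on `Q'`
  have hsol' : IsDistributionalNSSolutionOn Qo' 1 0 u p := hsol.of_le hQoQ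
  have hG' : HasWeakSpatialGradientOn (NSBootstrap.cylOpens (R₁ ^ 2) ρm) u G := hG.mono hQoQ
  have hdiv : ∀ θ : ℝ → EuclideanSpace ℝ (Fin 3) → ℝ, IsSpaceTimeTestOn (NSBootstrap.cylOpens (R₁ ^ 2) ρm) θ →
      ∫ z in NSBootstrap.cyl (R₁ ^ 2) ρm, ⟪u z.1 z.2, gradient (θ z.1) z.2⟫ = 0 :=
    fun θ hθ => hsol'.2.2.2.1 θ hθ
  have hP : NSBootstrap.BasePoisson u G (R₁ ^ 2) ρm := NSBootstrap.basePoisson_of_weakGradient hdiv hG'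
  -- Step 4: each entry of `G` in `L²(Q'')` with the bound
  have hentry : ∀ b i : Fin 3,
      eLpNorm (NSSpinHeat.gradE G b i) 2 (volume.restrict Q'') ≤ ENNReal.ofReal (K₀ * N) := by
    intro b i
    obtain ⟨Gf, hGfm, hGfn, hGfrep⟩ := hC₂ (fun q => u q.1 q.2 b) (fun c => spinEntry G b c)
      (hU b).1 (fun c => (hA b c).1) (fun ψ hψ => hP b ψ hψ) i
    have hrep : RepDeriv.IsRepDeriv Qo'' (fun q => u q.1 q.2 b) [EuclideanSpace.basisFun (Fin 3) ℝ i]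
        (NSSpinHeat.gradE G b i) := isRepDeriv_gradE hG hQo''Q b i
    have hae0 := RepDeriv.IsRepDeriv.ae_eq hGfrep hrep
    have hae : NSSpinHeat.gradE G b i =ᵐ[volume.restrict Q''] Gf := by
      rw [Filter.EventuallyEq, ae_restrict_iff' hQ''meas]
      filter_upwards [hae0] with q hq hqQ
      exact (hq hqQ).symm
    rw [eLpNorm_congr_ae hae]
    refine hGfn.trans ?_
    have hfinA : ∀ c : Fin 3, eLpNorm (spinEntry G b c) 2 (volume.restrict Q') ≠ ⊤ :=
      fun c => (hA b c).1.eLpNorm_ne_top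
    calc (C₂ : ℝ≥0∞) * (eLpNorm (fun q : ℝ × EuclideanSpace ℝ (Fin 3) => u q.1 q.2 b) 2 (volume.restrict Q') +
          ∑ c, eLpNorm (spinEntry G b c) 2 (volume.restrict Q'))
        ≤ (C₂ : ℝ≥0∞) * (ENNReal.ofReal (V * |M|) + ∑ _c : Fin 3, ENNReal.ofReal (C₁ * N)) := by
          gcongr with c _
          · exact (hU b).2
          · exact (hA b c).2
      _ = ENNReal.ofReal ((C₂ : ℝ) * (V * |M| + 3 * (C₁ * N))) := by
          rw [Finset.sum_const, Finset.card_univ, Fintype.card_fin, nsmul_eq_mul]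
          rw [ENNReal.ofReal_mul C₂.coe_nonneg, ENNReal.ofReal_coe_nnreal,
            ENNReal.ofReal_add (by positivity) (by positivity), ENNReal.ofReal_mul (by norm_num : (0:ℝ) ≤ 3)]
          norm_num
      _ ≤ ENNReal.ofReal (K₀ * N) := by
          refine ENNReal.ofReal_le_ofReal ?_
          rw [hK₀]
          have : (C₂ : ℝ) * (V * |M|) ≤ (C₂ : ℝ) * (V * N) :=
            mul_le_mul_of_nonneg_left (mul_le_mul_of_nonneg_left hMN hV0) C₂.coe_nonneg
          nlinarith [C₂.coe_nonneg, hC₁0, hN0, hV0]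
  -- Step 5: the Frobenius norm is the sum of the squared entries
  have hGm : AEStronglyMeasurable (uncurry G) (volume.restrict Q'') :=
    (hG.locallyIntegrableOn_grad.mono_set (fun q hq => hQ'Q (hQ''Q' hq))).aestronglyMeasurable
  have hgradEm : ∀ b i : Fin 3, AEStronglyMeasurable (NSSpinHeat.gradE G b i) (volume.restrict Q'') :=
    fun b i => ((NSSpinHeat.locallyIntegrableOn_gradE hG.locallyIntegrableOn_grad b i).mono_set
      (fun q hq => hQ'Q (hQ''Q' hq))).aestronglyMeasurable
  have hr : ∀ r : ℝ, ENNReal.ofReal (r ^ 2) = ‖r‖ₑ ^ (2 : ℝ) := fun r => by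
    rw [ENNReal.rpow_two, Real.enorm_eq_ofReal_abs, ← ENNReal.ofReal_pow (abs_nonneg r), sq_abs]
  have hfrob : ∀ q : ℝ × EuclideanSpace ℝ (Fin 3), ENNReal.ofReal (frobeniusNormSq (G q.1 q.2)) =
      ∑ i, ∑ b, ‖NSSpinHeat.gradE G b i q‖ₑ ^ (2 : ℝ) := by
    intro q
    rw [frobeniusNormSq_eq_sum (EuclideanSpace.basisFun (Fin 3) ℝ),
      ENNReal.ofReal_sum_of_nonneg (fun i _ => by positivity)]
    refine Finset.sum_congr rfl fun i _ => ?_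
    rw [EuclideanSpace.norm_sq_eq, ENNReal.ofReal_sum_of_nonneg (fun b _ => by positivity)]
    refine Finset.sum_congr rfl fun b _ => ?_
    have e1 : (EuclideanSpace.basisFun (Fin 3) ℝ i : EuclideanSpace ℝ (Fin 3)) =
        EuclideanSpace.single i (1 : ℝ) := by simp
    simp only [NSSpinHeat.gradE_apply, e1, Real.norm_eq_abs, sq_abs]
    exact hr _
  have hsq : ∀ b i : Fin 3, ∫⁻ q in Q'', ‖NSSpinHeat.gradE G b i q‖ₑ ^ (2 : ℝ) ≤
      ENNReal.ofReal (K₀ * N) ^ (2 : ℝ) := by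
    intro b i
    rw [← RepDeriv.eLpNorm_two_rpow_two]
    exact ENNReal.rpow_le_rpow (hentry b i) (by norm_num)
  calc ∫⁻ q in Q'', ENNReal.ofReal (frobeniusNormSq (G q.1 q.2))
      = ∫⁻ q in Q'', ∑ i, ∑ b, ‖NSSpinHeat.gradE G b i q‖ₑ ^ (2 : ℝ) := lintegral_congr fun q => hfrob q
    _ = ∑ i, ∑ b, ∫⁻ q in Q'', ‖NSSpinHeat.gradE G b i q‖ₑ ^ (2 : ℝ) := by
        rw [lintegral_finsetSum' _ fun i _ => ?_]
        · refine Finset.sum_congr rfl fun i _ => lintegral_finsetSum' _ fun b _ => ?_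
          exact (hgradEm b i).enorm.pow_const _
        · exact Finset.aemeasurable_fun_sum _ fun b _ => (hgradEm b i).enorm.pow_const _
    _ ≤ ∑ _i : Fin 3, ∑ _b : Fin 3, ENNReal.ofReal (K₀ * N) ^ (2 : ℝ) :=
        Finset.sum_le_sum fun i _ => Finset.sum_le_sum fun b _ => hsq b i
    _ = 9 * ENNReal.ofReal (K₀ * N) ^ (2 : ℝ) := by
        rw [Finset.sum_const, Finset.sum_const, Finset.card_univ, Fintype.card_fin, nsmul_eq_mul,
          nsmul_eq_mul]
        push_cast; ring
    _ = ENNReal.ofReal (9 * K₀ ^ 2 * (|M| + M ^ 2) ^ 2) := by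
        rw [← hN, ENNReal.ofReal_rpow_of_nonneg (by positivity) (by norm_num),
          show (9 : ℝ≥0∞) = ENNReal.ofReal 9 by norm_num, ← ENNReal.ofReal_mul (by norm_num)]
        congr 1
        rw [Real.rpow_two]; ring

end Serrin

end Summit.NavierStokesRegularity.NavierStokesRegularity.Theorems.ScalingDefectPeepholeDoor

end
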